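import Literature.NumberTheory.LFunctions.FordProgram1Run37A
import Literature.NumberTheory.LFunctions.FordProgram1Run37B
import Literature.NumberTheory.LFunctions.FordProgram1Run37C
import HarnessLib

/-!
# Ford's "Program 1": kernel run 37 (`1101 ≤ k ≤ 1115`)

Topic `Literature/NumberTheory/LFunctions`. Everything here is PROVED (standard axioms):
`FordP1.checkT k = true` for `1101 ≤ k ≤ 1115`, i.e. the certified re-run of PROGRAM 1 of
K. Ford, Proc. LMS 85 (2002) (the second part of Theorem 3) for these `k` — see `FordProgram1.lean`
for the checker, its soundness `FordP1.row_of_checkK`, and the meaning of the constants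
(`ρ = FordP1.rhoOf k / 10⁵`, `θ = FordP1.thetaOf k / 10⁴`, `ω = FordP1.omOf k / 10⁴`).

The kernel evaluations themselves live in `FordProgram1Run37A.lean` (`1101 ≤ k ≤ 1106`),
`FordProgram1Run37B.lean` (`1107 ≤ k ≤ 1111`) and `FordProgram1Run37C.lean` (`1112 ≤ k ≤ 1115`),
one `decide +kernel` per `k` (a single fifteen-`k` kernel evaluation in one declaration exceeded the
full build's per-file resources); this file only assembles them into the range statement
`FordP1.run37` in its original `List.all` form. The assembly of all runs is `FordTheorem3SmallK.lean`.

## References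

* K. Ford, Proc. London Math. Soc. (3) 85 (2002), 565–633; arXiv:1910.08209: Theorem 3, (1.7),
  Lemmas 3.4–3.5, Appendix "PROGRAM 1". [Ford2002]
-/

namespace Literature.NumberTheory.LFunctions
namespace FordP1

/-- **Kernel run 37**: `checkT k` for `1101 ≤ k ≤ 1115` (assembled from `run37A`, `run37B`,
`run37C`). [cite: Ford2002, Theorem 3 (second part) and PROGRAM 1] -/
theorem run37 : ((List.range' 1101 15).all checkT) = true := by
  rw [List.all_eq_true]
  intro k hk
  rw [List.mem_range'_1] at hk
  obtain ⟨h1, h2⟩ := hk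
  by_cases hA : k ≤ 1106
  · exact run37A k h1 hA
  · by_cases hB : k ≤ 1111
    · exact run37B k (by omega) hB
    · exact run37C k (by omega) (by omega)

end FordP1
end Literature.NumberTheory.LFunctions
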